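import Summits.BirchSwinnertonDyer.Rank1Residual.WAll.TargetAdditiveAtThreeWildTwinSlices
import Summits.BirchSwinnertonDyer.Rank1Residual.Additive.WildThreeRefinedKolyvagin
import HarnessLib
import HarnessLib.Audit.Tags

/-!
# Rung W-ALL, row 2 at `p = 3`: the wild rank-one ONTO atom cut along 3-adic TOWER surjectivity —
# the attacked cell and the declared residual of route `SemiOrdinaryEisensteinDescent` as named leaves
# (cell `bsd-wall`, lane (2), seat `bsd-wall-ty-1` g9; new small file importing
# `WAll.TargetAdditiveAtThreeWildTwinSlices`)

HONEST FRAMING (run/shared/lean/pub/bsd-wall/; brief `WALL-BRIEF-v1.md` sha16 b966bf16da27706e §2; cell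
`TYPING-CHECKLIST.md` T7 «residuals are leaf-verbatim»): BOOKKEEPING ONLY — nothing asserted, nothing
booked, no named fact, no published theorem restated; every `@[conjecture]` below is an OPEN obligation
shape of the W-ALL books, and every theorem is excluded middle on ONE predicate.

THE CUT. The landed onto atom `WAllExclAddWildRankOneSurj` (`TargetAdditiveAtThreePotSSImage.lean`
:141; non-CM, `Additive.ClassO6 W 3`, `ρ̄_{E,3}` onto `GL₂(𝔽₃)`, `r = 1` ⇒ `BSD(E,3)`; 3 894 → 3 893 classes
of record) is the closes-target of the sixth lane-3 route `route-BirchSwinnertonDyer-SemiOrdinaryEisensteinDescent`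
(SOED; planner `bsd-wall-pss3` g4, DRAFT rev 1 2026-08-27T14:2xZ, rung label «W-ALL/2@3.O6.r1.surj»). Its
kernel `EisensteinKernelAtThree` (item 20485) reads `BSD₃` on the rows whose 3-ADIC TOWER
`ρ_{E,3ⁿ} : Γ_ℚ → GL₂(ℤ/3ⁿ)` is onto for every `n ≥ 1` (`Rank1Residual.AdditiveThree.TowerSurjThree`,
`Additive/WildThreeRefinedKolyvagin.lean` :138 — Kolyvagin's `3 ∉ B(E)`; NOT implied by onto mod `3`,
Elkies' mod-`9` defects) and DECLARES the complement residual: item stmt-BirchSwinnertonDyer-20484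
`WildRankOneSurjNonTowerAtThree` («onto mod 3, tower not onto, r = 1 ⇒ BSD₃»; mass uncensused — census
ask «galrep mod 9 on the 3 894 classes» pending). This file names both sides as W-ALL leaves:

* `WAllExclAddWildRankOneSurjTower` :  the ATTACKED CELL of SOED (onto ∧ tower-onto).
* `WAllExclAddWildRankOneSurjNonTower` : the RESIDUAL = item 20484 VERBATIM (same binder order
  `¬CM → ClassO6 → Surj → ¬TowerSurjThree → r = 1`; `Iff.rfl` against the Theses decl, scratch-checked).

Glue (excluded middle on `TowerSurjThree W`, EXACT): `wAllExclAddWildRankOneSurj_iff_tower_nonTower`;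
each slice ⇐ the onto atom ⇐ `WAllExclAddWildRankOne` ⇐ `WAll`; registry key
`wAllExclAddWildRankOne_of_towerAtoms` (wild r1 ⇐ reducible ∧ tower ∧ non-tower ∧ normaliser). The tower
cut is INDEPENDENT of the twin cut of `TargetAdditiveAtThreeWildTwinSlices.lean` (UTD's cell): both are
exact partitions of the same onto atom; `wAllExclAddWildRankOneSurjTwin_of_tower_of_nonTower` etc. record
the cross implications that need no choice.

References: `WAll/TargetAdditiveAtThreePotSSImage.lean` (the onto atom and `wAllExclAddWildRankOne_iff_images`),
`WAll/TargetAdditiveAtThreeWildTwinSlices.lean` (twin cut), `Additive/WildThreeRefinedKolyvagin.lean`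
(`TowerSurjThree`), `Theses/SemiOrdinaryEisensteinDescent.lean` (items 20484 / 20485 / 20486); HOME
`WALL-TABLE.md` row 2·3@3, `bsd-wall-ty-1/LEAF-FQNS.md`; [cite: GrossLMS1991, §1 (the set B(E))];
[cite: Miller2011LMS, §1 and Def. 1.1] (the currency `BSD(E,p)`).
-/

noncomputable section

open scoped Classical

open WeierstrassCurve Literature.NumberTheory.EllipticCurves
  Literature.NumberTheory.EllipticCurves.Rank1Residual Literature.NumberTheory.EllipticCurves.ModularForms
open Summit.BirchSwinnertonDyer.Rank1Residual

set_option autoImplicit false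

namespace Summit.BirchSwinnertonDyer

/-! ### §1. The onto atom cut along «3-adic tower onto» -/

/-- **Wild additive `3`, rank one, onto mod `3` AND tower-onto (OPEN)** — the ATTACKED CELL of route
`SemiOrdinaryEisensteinDescent`: non-CM, `Additive.ClassO6 W 3`, `ρ̄_{E,3}` onto, `ρ_{E,3ⁿ}` onto for all
`n ≥ 1` (`AdditiveThree.TowerSurjThree W`), `r = 1` ⇒ `BSD(E,3)`. Mass: the 3 893 onto classes of record
minus the (uncensused, «rare») mod-`9`-defect rows. [folklore] -/
@[conjecture] def WAllExclAddWildRankOneSurjTower : Prop :=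
  ∀ (W : WeierstrassCurve ℚ) [W.IsElliptic] [W.IsGloballyMinimal],
    ¬ W.HasCM → Additive.ClassO6 W 3 → W.HasSurjectiveModNGaloisRep 3 →
      AdditiveThree.TowerSurjThree W → W.analyticRank = 1 → BSDp W 3

/-- **Wild additive `3`, rank one, onto mod `3`, tower NOT onto (OPEN)** — the statement of route item
`WildRankOneSurjNonTowerAtThree` (stmt-BirchSwinnertonDyer-20484) VERBATIM, the declared residual of
`SemiOrdinaryEisensteinDescent`: non-CM, `Additive.ClassO6 W 3`, `ρ̄_{E,3}` onto but
`¬ AdditiveThree.TowerSurjThree W` (some `ρ_{E,3ⁿ}`, `n ≥ 2`, not onto: Elkies' mod-`9` defects),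
`r = 1` ⇒ `BSD(E,3)`. [folklore] -/
@[conjecture] def WAllExclAddWildRankOneSurjNonTower : Prop :=
  ∀ (W : WeierstrassCurve ℚ) [W.IsElliptic] [W.IsGloballyMinimal],
    ¬ W.HasCM → Additive.ClassO6 W 3 → W.HasSurjectiveModNGaloisRep 3 →
      ¬ AdditiveThree.TowerSurjThree W → W.analyticRank = 1 → BSDp W 3

/-! ### §2. Glue (excluded middle only) -/

/-- **Onto atom ⟺ tower cell ∧ non-tower residual** (excluded middle on `TowerSurjThree W`; EXACT).
[folklore] -/
theorem wAllExclAddWildRankOneSurj_iff_tower_nonTower :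
    WAllExclAddWildRankOneSurj ↔
      WAllExclAddWildRankOneSurjTower ∧ WAllExclAddWildRankOneSurjNonTower :=
  ⟨fun h ↦ ⟨fun W _ _ hcm hO hs _ hr ↦ h W hcm hO hs hr, fun W _ _ hcm hO hs _ hr ↦ h W hcm hO hs hr⟩,
    fun ⟨hT, hN⟩ W _ _ hcm hO hs hr ↦ by
      by_cases ht : AdditiveThree.TowerSurjThree W
      · exact hT W hcm hO hs ht hr
      · exact hN W hcm hO hs ht hr⟩

/-- Onto atom ⇐ the two tower slices (the shape SOED's `closes` + its residual item feed). [folklore] -/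
theorem wAllExclAddWildRankOneSurj_of_tower_of_nonTower (hT : WAllExclAddWildRankOneSurjTower)
    (hN : WAllExclAddWildRankOneSurjNonTower) : WAllExclAddWildRankOneSurj :=
  wAllExclAddWildRankOneSurj_iff_tower_nonTower.2 ⟨hT, hN⟩

/-- The two tower slices ⇐ the onto atom. [folklore] -/
theorem towerSlices_of_wAllExclAddWildRankOneSurj (h : WAllExclAddWildRankOneSurj) :
    WAllExclAddWildRankOneSurjTower ∧ WAllExclAddWildRankOneSurjNonTower :=
  wAllExclAddWildRankOneSurj_iff_tower_nonTower.1 h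

/-- The two tower slices ⇐ the wild rank-one leaf `WAllExclAddWildRankOne`. [folklore] -/
theorem towerSlices_of_wAllExclAddWildRankOne (h : WAllExclAddWildRankOne) :
    WAllExclAddWildRankOneSurjTower ∧ WAllExclAddWildRankOneSurjNonTower :=
  towerSlices_of_wAllExclAddWildRankOneSurj (wAllExclAddWildRankOne_iff_images.1 h).2.1

/-- The two tower slices follow from `WAll` (each is an instance of it). [folklore] -/
theorem towerSlices_of_wAll (h : WAll) :
    WAllExclAddWildRankOneSurjTower ∧ WAllExclAddWildRankOneSurjNonTower :=
  towerSlices_of_wAllExclAddWildRankOne (cellsAtThree_of_wAll h).2.2.2.2.2.2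

/-! ### §3. Registry key and the cross implications with the twin cut -/

/-- **Wild rank one (`WAllExclAddWildRankOne`, the registered slice) ⇐ reducible ∧ tower ∧ non-tower ∧
normaliser** — the image menu of `wAllExclAddWildRankOne_iff_images` with the onto atom read through the
tower cut; feed the result where `Rank1Residual.WAll` registries take `WAllExclAddWildRankOne`.
[folklore] -/
theorem wAllExclAddWildRankOne_of_towerAtoms (hR : WAllExclAddWildRankOneRed)
    (hT : WAllExclAddWildRankOneSurjTower) (hN : WAllExclAddWildRankOneSurjNonTower)
    (hNS : WAllExclAddWildRankOneIrrNotSurj) : WAllExclAddWildRankOne :=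
  wAllExclAddWildRankOne_iff_images.2 ⟨hR, wAllExclAddWildRankOneSurj_of_tower_of_nonTower hT hN, hNS⟩

/-- Tower slices ⇒ the twin slices of UTD's cut (through the common onto atom). [folklore] -/
theorem twinSlices_of_tower_of_nonTower (hT : WAllExclAddWildRankOneSurjTower)
    (hN : WAllExclAddWildRankOneSurjNonTower) :
    WAllExclAddWildRankOneSurjTwin ∧ WAllExclAddWildRankOneSurjTwinless :=
  wAllExclAddWildRankOneSurj_iff_surjTwin_surjTwinless.1
    (wAllExclAddWildRankOneSurj_of_tower_of_nonTower hT hN)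

/-- Twin slices ⇒ the tower slices (through the common onto atom). [folklore] -/
theorem towerSlices_of_surjTwin_of_surjTwinless (hC : WAllExclAddWildRankOneSurjTwin)
    (hL : WAllExclAddWildRankOneSurjTwinless) :
    WAllExclAddWildRankOneSurjTower ∧ WAllExclAddWildRankOneSurjNonTower :=
  towerSlices_of_wAllExclAddWildRankOneSurj
    (wAllExclAddWildRankOneSurj_iff_surjTwin_surjTwinless.2 ⟨hC, hL⟩)

end Summit.BirchSwinnertonDyer
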